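import Literature.AnabelianGeometry.EtaleTheta.Discharge.Sec4GaloisSurjNaturalModel
import Literature.AnabelianGeometry.SemiGraphs.TemperoidsGaloisHomTorsor
import Literature.AnabelianGeometry.EtaleTheta.BiKummerGaloisSurjLaws
import Literature.AnabelianGeometry.EtaleTheta.BiKummerOfModelCanonical
import HarnessLib

/-!
# [SemiAnbd] Rmk. 3.1.3 / [EtTh] Def. 4.1 (ii): the Galois surjections `Π ↠ Aut(A)` RESTRICTED TO THE CONNECTED PART `B^temp(Π)⁰`,
# with their three laws (surjective · natural up to inner automorphism · open kernel)

Mochizuki, *Semi-graphs of anabelioids*, Publ. RIMS **42** (2006), §3, Rmk. 3.1.3 p.34 (`A ≅ Π/N_A`, `Aut(Π/N_A) = Π/N_A`)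
[cite: MochizukiSemiAnbd2006, Rmk 3.1.3 p.34]; Mochizuki, *The étale theta function …*, Publ. RIMS **45** (2009), Def. 4.1 (ii) p.313
(PDF p.87) ("natural surjective outer homomorphism `Π^tp_X ↠ Aut_D(A^bs)`"), Def. 3.6 (ii) p.302 (PDF p.76) (the base `D` is a
CONNECTED, totally epimorphic category — print's `B^temp(Π)⁰`) [cite: MochizukiEtTh2009, Def 4.1 (ii) p.313 (PDF p.87)].

PROOF-ONLY (no definitions; seat abc-iut-w4-d099, cell abc-iut layer L2/L3; re-basing kit after the vacuity certificate
`EtaleTheta/Discharge/Sec3TemperedFrobenioidBTempVacuity.lean`: no tempered Frobenioid has base the FULL temperoid `BTemp Π`, so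
the §4/§5 "canonical model" settings must be fed Galois data over `ConnectedPart (BTemp Π) = B^temp(Π)⁰`).  abc-iut-w5-d013's
`GaloisObjects.galoisSurjOf hG A hA : Π →* Aut A` (for `A : BTemp Π` Galois) is moved to an object `A` of the full subcategory
`B^temp(Π)⁰` by the canonical `Aut A ≃* Aut A.obj` of the fully faithful inclusion (Mathlib
`Functor.FullyFaithful.autMulEquivOfFullyFaithful`); NO new constant is introduced — every statement spells out the composite

  `galoisSurjOf⁰ A hA := ((connectedObjects (BTemp Π)).fullyFaithfulι.autMulEquivOfFullyFaithful A).symm ∘ galoisSurjOf hG A.obj hA`,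

so that a re-based canonical setting `BiKummerSetting.mkOfModelCanonical X tf … (fun A => IsGaloisObj A.obj) (galoisSurjOf⁰) …` over
`D := ConnectedPart (BTemp Π^tp_X)` can cite the laws BY NAME:
* `galoisSurjOf_connectedPart_hom` — the underlying `B^temp(Π)`-arrow of `galoisSurjOf⁰ A hA g` is that of `galoisSurjOf hG A.obj hA g`;
* `galoisSurjOf_connectedPart_surjective` — Def. 4.1 (ii) "surjective" (the `galoisSurj_surjective` input of `mkOfModelCanonical`);
* `galoisSurjOf_connectedPart_natural` — Def. 4.1 (ii) "natural … OUTER": naturality up to an inner automorphism of `Π`, in the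
  exact binder shape of `BiKummerSetting.GaloisSurjNatural` (from w5-d013's `galoisSurjOf_natural`);
* `ker_galoisSurjOf_connectedPart`, `isOpen_ker_galoisSurjOf_connectedPart` — the kernel is unchanged (`= N_A`, open), the shape of
  `BiKummerSetting.IsOpenKerGaloisSurj`.
(The fourth law used by §5, "Galois objects are `Aut`-torsors over every target", is `galoisHomTorsor_of_connectedPart`,
`EtaleTheta/Discharge/Sec5Prop55GaloisLeafConnectedBase.lean`.)

PART B — **the NON-VACUOUS canonical model setting.**  For a tempered Frobenioid `tf` over `D := ConnectedPart (BTemp Π^tp_X)` (an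
inhabitable parameter type as far as the category axioms go: `QuasiTemperoid.BTempConnected.connectedPart_isConnected` /
`connectedPart_isTotallyEpimorphic`) and abc-iut-L2-t9's `BiKummerSetting.mkOfModelCanonical` fed with the Galois data
`(fun A => IsGaloisObj A.obj, galoisSurjOf⁰)`, the three interface laws are THEOREMS:
`mkOfModelCanonical_connectedPart_galoisSurjNatural` (`BiKummerSetting.GaloisSurjNatural`),
`mkOfModelCanonical_connectedPart_isOpenKerGaloisSurj` (`BiKummerSetting.IsOpenKerGaloisSurj`),
`mkOfModelCanonical_connectedPart_galoisHomTorsor` (law (L1) of GAP row G-w4d099-1) — the replacement for the `section Canonical`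
of `Sec4GaloisSurjNaturalModel.lean` / `Sec4GaloisSurjLawsModel.lean`, whose parameter `tf : TemperedFrobenioid T (BTemp X.Pi) VD`
ranges over an EMPTY type.  Plain category/group plumbing; nothing of [SemiAnbd]/[EtTh] is asserted; no side taken on [IUTchIII]
Cor. 3.12.
-/

noncomputable section

open CategoryTheory Topology

namespace Literature.AnabelianGeometry.SemiGraphs

namespace GaloisObjects

open Literature.AlgebraicGeometry.Frobenioids (IsConnectedObj ConnectedPart connectedObjects)

universe u

variable {G : Type u} [Group G] [TopologicalSpace G] [IsTopologicalGroup G] (hG : IsTempered G)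

omit [IsTopologicalGroup G] in
/-- The underlying `B^temp(Π)`-arrow of the transported automorphism: for `σ ∈ Aut(A.obj)`, the automorphism of `A` in `B^temp(Π)⁰`
obtained through the fully faithful inclusion has `hom`-component `σ.hom`.  [cite: MochizukiSemiAnbd2006, Rmk 3.1.3 p.34] -/
theorem autMulEquiv_connectedPart_symm_hom (A : ConnectedPart (BTemp G)) (σ : Aut A.obj) :
    (((connectedObjects (BTemp G)).fullyFaithfulι.autMulEquivOfFullyFaithful A).symm σ).hom.hom = σ.hom := rfl

/-- **The Galois surjection on `B^temp(Π)⁰`, underlying arrow**: `(galoisSurjOf⁰ A hA g).hom.hom = (galoisSurjOf hG A.obj hA g).hom`.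
[cite: MochizukiEtTh2009, Def 4.1 (ii) p.313 (PDF p.87)] -/
theorem galoisSurjOf_connectedPart_hom (A : ConnectedPart (BTemp G)) (hA : IsGaloisObj A.obj) (g : G) :
    ((((connectedObjects (BTemp G)).fullyFaithfulι.autMulEquivOfFullyFaithful A).symm.toMonoidHom.comp
        (galoisSurjOf hG A.obj hA)) g).hom.hom = (galoisSurjOf hG A.obj hA g).hom := rfl

/-- **Def. 4.1 (ii) "surjective" on `B^temp(Π)⁰`**: `galoisSurjOf⁰ A hA : Π → Aut_{B^temp(Π)⁰}(A)` is surjective.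
[cite: MochizukiEtTh2009, Def 4.1 (ii) p.313 (PDF p.87)] -/
theorem galoisSurjOf_connectedPart_surjective (A : ConnectedPart (BTemp G)) (hA : IsGaloisObj A.obj) :
    Function.Surjective
      (((connectedObjects (BTemp G)).fullyFaithfulι.autMulEquivOfFullyFaithful A).symm.toMonoidHom.comp
        (galoisSurjOf hG A.obj hA)) :=
  ((connectedObjects (BTemp G)).fullyFaithfulι.autMulEquivOfFullyFaithful A).symm.surjective.comp
    (galoisSurjOf_surjective hG A.obj hA)

/-- **Def. 4.1 (ii) "natural … OUTER" on `B^temp(Π)⁰`** (the binder shape of `BiKummerSetting.GaloisSurjNatural`): along every arrow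
`b : B → A` of `B^temp(Π)⁰` between Galois objects there is `c ∈ Π` with `galoisSurjOf⁰_B(g) ≫ b = b ≫ galoisSurjOf⁰_A(c g c⁻¹)` for
all `g` — abc-iut-w5-d013's `galoisSurjOf_natural` read through the full subcategory.  [cite: MochizukiEtTh2009, Def 4.1 (ii) p.313 (PDF p.87)] -/
theorem galoisSurjOf_connectedPart_natural ⦃A B : ConnectedPart (BTemp G)⦄ (hA : IsGaloisObj A.obj) (hB : IsGaloisObj B.obj)
    (b : B ⟶ A) : ∃ c : G, ∀ g : G,
      ((((connectedObjects (BTemp G)).fullyFaithfulι.autMulEquivOfFullyFaithful B).symm.toMonoidHom.comp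
          (galoisSurjOf hG B.obj hB)) g).hom ≫ b =
        b ≫ ((((connectedObjects (BTemp G)).fullyFaithfulι.autMulEquivOfFullyFaithful A).symm.toMonoidHom.comp
          (galoisSurjOf hG A.obj hA)) (c * g * c⁻¹)).hom := by
  obtain ⟨c, hc⟩ := galoisSurjOf_natural hG hA hB b.hom
  exact ⟨c, fun g => ObjectProperty.hom_ext _ (hc g)⟩

/-- **The kernel on `B^temp(Π)⁰` is that of `galoisSurjOf`** (the transport `Aut A.obj ≃ Aut A` is injective), i.e. the open normal
subgroup `N_A` of the chosen presentation `A ≅ Π/N_A`.  [cite: MochizukiSemiAnbd2006, Rmk 3.1.3 p.34] -/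
theorem ker_galoisSurjOf_connectedPart (A : ConnectedPart (BTemp G)) (hA : IsGaloisObj A.obj) :
    (((connectedObjects (BTemp G)).fullyFaithfulι.autMulEquivOfFullyFaithful A).symm.toMonoidHom.comp
        (galoisSurjOf hG A.obj hA)).ker = (galoisSurjOf hG A.obj hA).ker := by
  ext g
  rw [MonoidHom.mem_ker, MonoidHom.mem_ker, MonoidHom.comp_apply, MulEquiv.coe_toMonoidHom, MulEquiv.map_eq_one_iff]
  exact Iff.rfl

/-- **Def. 4.1 (ii), topological clause on `B^temp(Π)⁰`** (the shape of `BiKummerSetting.IsOpenKerGaloisSurj`): the kernel of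
`galoisSurjOf⁰ A hA` is OPEN — w5-d013's `isOpen_ker_galoisSurjOf`.  [cite: MochizukiEtTh2009, Def 4.1 (ii) p.313 (PDF p.87)] -/
theorem isOpen_ker_galoisSurjOf_connectedPart (A : ConnectedPart (BTemp G)) (hA : IsGaloisObj A.obj) :
    IsOpen ((((connectedObjects (BTemp G)).fullyFaithfulι.autMulEquivOfFullyFaithful A).symm.toMonoidHom.comp
        (galoisSurjOf hG A.obj hA)).ker : Set G) := by
  rw [ker_galoisSurjOf_connectedPart]
  exact isOpen_ker_galoisSurjOf hG A.obj hA

end GaloisObjects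

end Literature.AnabelianGeometry.SemiGraphs

/-! ## Part B: the canonical model setting over the connected base `B^temp(Π^tp_X)⁰` — laws as theorems -/

namespace Literature.AnabelianGeometry.EtaleTheta

namespace BiKummerSetting

open Literature.AlgebraicGeometry.Frobenioids Literature.AnabelianGeometry.SemiGraphs
  Literature.AnabelianGeometry.SemiGraphs.GaloisObjects

universe u₀ v₀ w

variable {K : Type u₀} [Field K] (X : SemiGraphs.TemperedArithmeticGroup.{u₀} K) {D₀ : Type u₀} [Category.{v₀} D₀]
  {V : FrdIMonoidStub.{w}} {T : RealifiedDivisorMonoids (D₀ := D₀) V}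
  {VD : FrdICatStub.{u₀ + 1, u₀, w} (ConnectedPart (BTemp X.Pi))}
  (tf : TemperedFrobenioid T (ConnectedPart (BTemp X.Pi)) VD) (hZ : tf.monoidType = MonoidType.Z)
  (hP : ∀ A : (ConnectedPart (BTemp X.Pi))ᵒᵖ, IsPerfect (tf.Φ.carrier A))
  (NH : Subgroup (Field.absoluteGaloisGroup K) → tf.category → ℕ+ → Prop) (A₀ : tf.category)
  (hA₀ : PreFrobenioid.IsFrobeniusTrivial tf.toElem A₀) (hA₀' : SemiGraphs.IsGaloisObj A₀.base.obj)

/-- **`GaloisSurjNatural` HOLDS for the canonical model setting over `B^temp(Π^tp_X)⁰`** fed with `(IsGaloisObj ∘ obj, galoisSurjOf⁰)`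
— by `galoisSurjOf_connectedPart_natural`.  [cite: MochizukiEtTh2009, Def 4.1 (ii) p.313 (PDF p.87)] -/
theorem mkOfModelCanonical_connectedPart_galoisSurjNatural :
    (BiKummerSetting.mkOfModelCanonical X tf hZ hP (fun A => SemiGraphs.IsGaloisObj A.obj)
      (fun A h => ((connectedObjects (BTemp X.Pi)).fullyFaithfulι.autMulEquivOfFullyFaithful A).symm.toMonoidHom.comp
        (galoisSurjOf X.isTempered A.obj h))
      (fun A h => galoisSurjOf_connectedPart_surjective X.isTempered A h) NH A₀ hA₀ hA₀').GaloisSurjNatural :=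
  galoisSurjOf_connectedPart_natural X.isTempered

/-- **`IsOpenKerGaloisSurj` HOLDS for the canonical model setting over `B^temp(Π^tp_X)⁰`** — by
`isOpen_ker_galoisSurjOf_connectedPart`.  [cite: MochizukiEtTh2009, Def 4.1 (ii) p.313 (PDF p.87)] -/
theorem mkOfModelCanonical_connectedPart_isOpenKerGaloisSurj :
    (BiKummerSetting.mkOfModelCanonical X tf hZ hP (fun A => SemiGraphs.IsGaloisObj A.obj)
      (fun A h => ((connectedObjects (BTemp X.Pi)).fullyFaithfulι.autMulEquivOfFullyFaithful A).symm.toMonoidHom.comp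
        (galoisSurjOf X.isTempered A.obj h))
      (fun A h => galoisSurjOf_connectedPart_surjective X.isTempered A h) NH A₀ hA₀ hA₀').IsOpenKerGaloisSurj :=
  fun A hA => isOpen_ker_galoisSurjOf_connectedPart X.isTempered A hA

/-- **Law (L1) «Galois objects are `Aut`-torsors over every target» HOLDS for the canonical model setting over `B^temp(Π^tp_X)⁰`**
(GAP row G-w4d099-1, in its binder shape `hGalT`) — by `GaloisObjects.exists_aut_comp_eq_of_isGaloisObj_connectedPart` (equivalently `galoisHomTorsor_of_connectedPart` of `Sec5Prop55GaloisLeafConnectedBase.lean` with the identity `hIG`).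
[cite: MochizukiSemiAnbd2006, Rmk 3.1.3 p.34] -/
theorem mkOfModelCanonical_connectedPart_galoisHomTorsor :
    ∀ ⦃A : ConnectedPart (BTemp X.Pi)⦄,
      (BiKummerSetting.mkOfModelCanonical X tf hZ hP (fun A => SemiGraphs.IsGaloisObj A.obj)
        (fun A h => ((connectedObjects (BTemp X.Pi)).fullyFaithfulι.autMulEquivOfFullyFaithful A).symm.toMonoidHom.comp
          (galoisSurjOf X.isTempered A.obj h))
        (fun A h => galoisSurjOf_connectedPart_surjective X.isTempered A h) NH A₀ hA₀ hA₀').IsGaloisObj A →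
      ∀ ⦃T' : ConnectedPart (BTemp X.Pi)⦄ (b b' : A ⟶ T'), ∃ g : Aut A, b' = g.hom ≫ b :=
  fun A hA T' b b' => GaloisObjects.exists_aut_comp_eq_of_isGaloisObj_connectedPart A T' hA b b'

end BiKummerSetting

end Literature.AnabelianGeometry.EtaleTheta

end
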